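import Mathlib.MeasureTheory.Integral.MeanInequalities
import Literature.NumberTheory.LFunctions.WeilGroundState
import HarnessLib

set_option linter.dupNamespace false

/-!
# Calibration stub `stub_calibration_END_of_RH` — auxiliary file 1: `L²` window functions

Helpers for the calibration stub of line `cofinite-weil-index-staircase` (crux
`RuelleBand.CofiniteCriticalLine`): the `L²`/`L¹` bookkeeping of a square-integrable `u` that is
the `L²`-limit of window test functions `gₙ` (`tsupport gₙ ⊆ [-a, a]`):

* `u` vanishes a.e. off the window, hence is integrable and has all exponential moments;
* its Mellin–Laplace transform `û = weilMellin u` is ENTIRE, with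
  `‖û(s)‖ ≤ ‖u‖₁ · e^{a |Re s − 1/2|}`;
* `ĝₙ(s) → û(s)` for every `s` (Cauchy–Schwarz on the window);
* `û ≡ 0` forces `u = 0` a.e. (Plancherel for `L¹ ∩ L²`,
  `Literature.Analysis.FunctionSpaces.eLpNorm_fourierIntegral_eq`, and
  `fourier_weilKernel`: `𝓕 u (w) = û(1/2 − 2πiw)`).

The proofs of the first three items are adapted from the `IsWeilGroundState` API of
`Literature/NumberTheory/LFunctions/WeilGroundState.lean` (same objects, without the
normalisation `∫ |gₙ|² = 1` and the minimising property, which play no role there).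
-/

noncomputable section

open Complex MeasureTheory Filter Set
open scoped BigOperators Topology ComplexConjugate FourierTransform Real

namespace Summit.RiemannHypothesis.RiemannHypothesis.Theorems.RuelleBandCofiniteCriticalLine

open Literature.NumberTheory.LFunctions

variable {a : ℝ} {u : ℝ → ℂ}

/-! ### Localisation and integrability -/

/-- **Localisation**: an `L²`-limit `u` of functions `gₙ` supported in `[-a, a]` vanishes a.e.
off the window: `∫_{[-a,a]ᶜ} |u|² = ∫_{[-a,a]ᶜ} |gₙ − u|² ≤ ∫ |gₙ − u|² → 0`
(adapted from `IsWeilGroundState.ae_eq_zero_of_notMem`). [folklore] -/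
theorem stub_calibration_END_of_RH_ae_zero_off (hu : MemLp u 2 volume) {g : ℕ → ℝ → ℂ}
    (hg : ∀ n, IsWeilTest (g n) ∧ tsupport (g n) ⊆ Icc (-a) a)
    (hlim : Tendsto (fun n => ∫ t, ‖g n t - u t‖ ^ 2) atTop (𝓝 0)) :
    ∀ᵐ t : ℝ, t ∉ Icc (-a) a → u t = 0 := by
  have hgm : ∀ n, MemLp (g n) 2 volume := fun n =>
    (hg n).1.1.continuous.memLp_of_hasCompactSupport (hg n).1.2
  set S : Set ℝ := (Icc (-a) a)ᶜ with hSdef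
  have hS : MeasurableSet S := measurableSet_Icc.compl
  have hint : ∀ n, Integrable (fun t => ‖g n t - u t‖ ^ 2) := fun n => by
    have hm : MemLp (fun t => g n t - u t) 2 volume := (hgm n).sub hu
    exact (memLp_two_iff_integrable_sq_norm hm.1).1 hm
  have hu2 : Integrable (fun t => ‖u t‖ ^ 2) := (memLp_two_iff_integrable_sq_norm hu.1).1 hu
  have hle : ∀ n, ∫ t in S, ‖u t‖ ^ 2 ≤ ∫ t, ‖g n t - u t‖ ^ 2 := fun n =>
    calc ∫ t in S, ‖u t‖ ^ 2 = ∫ t in S, ‖g n t - u t‖ ^ 2 := by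
          refine setIntegral_congr_fun hS fun t ht => ?_
          have h0 : g n t = 0 :=
            image_eq_zero_of_notMem_tsupport fun h' => ht ((hg n).2 h')
          simp only [h0, zero_sub, norm_neg]
      _ ≤ ∫ t, ‖g n t - u t‖ ^ 2 :=
          setIntegral_le_integral (hint n) (Eventually.of_forall fun t => by positivity)
  have hz : ∫ t in S, ‖u t‖ ^ 2 = 0 :=
    le_antisymm (ge_of_tendsto' hlim hle) (integral_nonneg fun t => by positivity)
  have hae : (fun t => ‖u t‖ ^ 2) =ᵐ[volume.restrict S] 0 :=
    (setIntegral_eq_zero_iff_of_nonneg_ae (Eventually.of_forall fun t => by positivity)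
      hu2.integrableOn).1 hz
  have hae' : ∀ᵐ t ∂(volume.restrict S), u t = 0 :=
    hae.mono fun t ht => by simpa using ht
  exact (ae_restrict_iff' hS).1 hae'

/-- A square-integrable function is integrable on the (compact) window. [folklore] -/
theorem stub_calibration_END_of_RH_integrableOn (hu : MemLp u 2 volume) :
    IntegrableOn u (Icc (-a) a) :=
  (hu.restrict (Icc (-a) a)).integrable one_le_two

/-- A square-integrable function vanishing a.e. off the window is integrable on `ℝ`. [folklore] -/
theorem stub_calibration_END_of_RH_integrable (hu : MemLp u 2 volume)
    (hz : ∀ᵐ t : ℝ, t ∉ Icc (-a) a → u t = 0) : Integrable u :=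
  (stub_calibration_END_of_RH_integrableOn hu).integrable_of_ae_notMem_eq_zero hz

/-- `u · w` is integrable for every continuous `w` (`w` is bounded on the compact window and `u`
vanishes a.e. off it). [folklore] -/
theorem stub_calibration_END_of_RH_integrable_mul_continuous (hu : MemLp u 2 volume)
    (hz : ∀ᵐ t : ℝ, t ∉ Icc (-a) a → u t = 0) {w : ℝ → ℂ} (hw : Continuous w) :
    Integrable fun t => u t * w t :=
  ((stub_calibration_END_of_RH_integrableOn (a := a) hu).mul_continuousOn hw.continuousOn
    isCompact_Icc).integrable_of_ae_notMem_eq_zero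
      (hz.mono fun t ht hts => by simp [ht hts])

/-! ### `û` is entire, of exponential type `≤ a` in `Re s` -/

/-- **`û` is entire**, with `û'(s) = ∫ u(t) t e^{(s-1/2)t} dt`: differentiation under the
integral sign, dominated on the ball `‖s − s₀‖ < 1` by `|u(t)| |t| e^{(‖s₀‖+2)|t|}`
(adapted from `IsWeilGroundState.hasDerivAt_weilMellin`). [folklore] -/
theorem stub_calibration_END_of_RH_hasDerivAt_weilMellin (hu : MemLp u 2 volume)
    (hz : ∀ᵐ t : ℝ, t ∉ Icc (-a) a → u t = 0) (s₀ : ℂ) :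
    HasDerivAt (weilMellin u) (∫ t : ℝ, u t * (t * cexp ((s₀ - 1 / 2) * t))) s₀ := by
  set A : ℝ := ‖s₀‖ + 2 with hA
  have hum : AEStronglyMeasurable u volume := hu.1
  have hF_meas : ∀ᶠ s in 𝓝 s₀,
      AEStronglyMeasurable (fun t : ℝ => u t * cexp ((s - 1 / 2) * t)) volume :=
    Eventually.of_forall fun s =>
      hum.mul (by fun_prop : Continuous fun t : ℝ => cexp ((s - 1 / 2) * t)).aestronglyMeasurable
  have hF_int : Integrable (fun t : ℝ => u t * cexp ((s₀ - 1 / 2) * t)) :=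
    stub_calibration_END_of_RH_integrable_mul_continuous hu hz (by fun_prop)
  have hF'_meas :
      AEStronglyMeasurable (fun t : ℝ => u t * (t * cexp ((s₀ - 1 / 2) * t))) volume :=
    hum.mul
      (by fun_prop : Continuous fun t : ℝ => (t : ℂ) * cexp ((s₀ - 1 / 2) * t)).aestronglyMeasurable
  have h_bound : ∀ᵐ t : ℝ, ∀ s ∈ Metric.ball s₀ 1,
      ‖u t * (t * cexp ((s - 1 / 2) * t))‖ ≤ ‖u t‖ * (|t| * Real.exp (A * |t|)) := by
    refine Eventually.of_forall fun t s hs => ?_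
    rw [norm_mul, norm_mul, Complex.norm_exp, Complex.norm_real, Real.norm_eq_abs]
    refine mul_le_mul_of_nonneg_left (mul_le_mul_of_nonneg_left (Real.exp_le_exp.2 ?_)
      (abs_nonneg _)) (norm_nonneg _)
    have hre : ((s - 1 / 2) * (t : ℂ)).re = (s.re - 1 / 2) * t := by simp [sub_re, mul_re]
    rw [hre]
    have hs' : ‖s - s₀‖ < 1 := by rwa [Metric.mem_ball, dist_eq_norm] at hs
    have h3 : |s.re - 1 / 2| ≤ A := by
      have e : s.re - 1 / 2 = (s - s₀).re + s₀.re + (-(1 / 2)) := by simp; ring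
      rw [e, hA]
      refine (abs_add_three _ _ _).trans ?_
      rw [abs_neg, abs_of_pos (by norm_num : (0 : ℝ) < 1 / 2)]
      linarith [abs_re_le_norm (s - s₀), abs_re_le_norm s₀]
    calc (s.re - 1 / 2) * t ≤ |(s.re - 1 / 2) * t| := le_abs_self _
      _ = |s.re - 1 / 2| * |t| := abs_mul _ _
      _ ≤ A * |t| := mul_le_mul_of_nonneg_right h3 (abs_nonneg _)
  have bound_integrable : Integrable fun t : ℝ => ‖u t‖ * (|t| * Real.exp (A * |t|)) :=
    (IntegrableOn.mul_continuousOn (stub_calibration_END_of_RH_integrableOn (a := a) hu).norm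
      (by fun_prop : Continuous fun t : ℝ => |t| * Real.exp (A * |t|)).continuousOn
      isCompact_Icc).integrable_of_ae_notMem_eq_zero
        (hz.mono fun t ht hts => by simp [ht hts])
  have h_diff : ∀ᵐ t : ℝ, ∀ s ∈ Metric.ball s₀ 1,
      HasDerivAt (fun s : ℂ => u t * cexp ((s - 1 / 2) * t))
        (u t * (t * cexp ((s - 1 / 2) * t))) s :=
    Eventually.of_forall fun t s _ => hasDerivAt_weilIntegrand u t s
  exact (hasDerivAt_integral_of_dominated_loc_of_deriv_le (Metric.ball_mem_nhds s₀ one_pos)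
    hF_meas hF_int hF'_meas h_bound bound_integrable h_diff).2

/-- `û = weilMellin u` is an entire function. [folklore] -/
theorem stub_calibration_END_of_RH_differentiable_weilMellin (hu : MemLp u 2 volume)
    (hz : ∀ᵐ t : ℝ, t ∉ Icc (-a) a → u t = 0) : Differentiable ℂ (weilMellin u) :=
  fun s => (stub_calibration_END_of_RH_hasDerivAt_weilMellin hu hz s).differentiableAt

/-- **Exponential type**: `‖û(s)‖ ≤ (∫ ‖u‖) · e^{a |Re s − 1/2|}` (on the window
`Re((s − 1/2)t) ≤ |Re s − 1/2| · a`; off it `u = 0` a.e.). [folklore] -/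
theorem stub_calibration_END_of_RH_norm_weilMellin_le (hu : MemLp u 2 volume)
    (hz : ∀ᵐ t : ℝ, t ∉ Icc (-a) a → u t = 0) (s : ℂ) :
    ‖weilMellin u s‖ ≤ (∫ t, ‖u t‖) * Real.exp (a * |s.re - 1 / 2|) := by
  unfold weilMellin
  refine (norm_integral_le_integral_norm _).trans ?_
  rw [← integral_mul_const]
  refine integral_mono_ae (stub_calibration_END_of_RH_integrable_mul_continuous hu hz
    (by fun_prop)).norm ((stub_calibration_END_of_RH_integrable hu hz).norm.mul_const _) ?_
  filter_upwards [hz] with t ht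
  by_cases hts : t ∈ Icc (-a) a
  · rw [norm_mul, Complex.norm_exp]
    refine mul_le_mul_of_nonneg_left (Real.exp_le_exp.2 ?_) (norm_nonneg _)
    have hre : ((s - 1 / 2) * (t : ℂ)).re = (s.re - 1 / 2) * t := by simp [sub_re, mul_re]
    rw [hre]
    have ht' : |t| ≤ a := abs_le.2 ⟨hts.1, hts.2⟩
    calc (s.re - 1 / 2) * t ≤ |(s.re - 1 / 2) * t| := le_abs_self _
      _ = |s.re - 1 / 2| * |t| := abs_mul _ _
      _ ≤ |s.re - 1 / 2| * a := mul_le_mul_of_nonneg_left ht' (abs_nonneg _)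
      _ = a * |s.re - 1 / 2| := mul_comm _ _
  · simp [ht hts]

/-! ### `L²`-continuity of `f ↦ f̂(s)` on the window -/

/-- Cauchy–Schwarz for two square-integrable scalar functions:
`∫ ‖A‖ ‖B‖ ≤ √(∫ ‖A‖²) √(∫ ‖B‖²)`. [folklore] -/
private theorem integral_norm_mul_norm_le_sqrt {α : Type*} [MeasurableSpace α] {μ : Measure α}
    {A B : α → ℂ} (hA : MemLp A 2 μ) (hB : MemLp B 2 μ) :
    ∫ x, ‖A x‖ * ‖B x‖ ∂μ ≤ √(∫ x, ‖A x‖ ^ 2 ∂μ) * √(∫ x, ‖B x‖ ^ 2 ∂μ) := by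
  have h2 : ENNReal.ofReal 2 = 2 := by norm_num
  have hA' : MemLp (fun x => ‖A x‖) (ENNReal.ofReal 2) μ := by rw [h2]; exact hA.norm
  have hB' : MemLp (fun x => ‖B x‖) (ENNReal.ofReal 2) μ := by rw [h2]; exact hB.norm
  have h := integral_mul_le_Lp_mul_Lq_of_nonneg Real.HolderConjugate.two_two
    (ae_of_all _ fun x => norm_nonneg (A x)) (ae_of_all _ fun x => norm_nonneg (B x)) hA' hB'
  simp only [Real.rpow_two] at h
  rw [Real.sqrt_eq_rpow, Real.sqrt_eq_rpow]
  exact h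

/-- Cauchy–Schwarz: `‖∫ A B‖ ≤ √(∫ ‖A‖²) √(∫ ‖B‖²)`. [folklore] -/
private theorem norm_integral_mul_le_sqrt {α : Type*} [MeasurableSpace α] {μ : Measure α}
    {A B : α → ℂ} (hA : MemLp A 2 μ) (hB : MemLp B 2 μ) :
    ‖∫ x, A x * B x ∂μ‖ ≤ √(∫ x, ‖A x‖ ^ 2 ∂μ) * √(∫ x, ‖B x‖ ^ 2 ∂μ) := by
  refine (norm_integral_le_integral_norm _).trans ?_
  simp only [norm_mul]
  exact integral_norm_mul_norm_le_sqrt hA hB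

/-- **`L²`-continuity of `f ↦ f̂(s)` on the window**: if `f ∈ L²` vanishes a.e. off `[-a, a]`
then `‖f̂(s)‖ ≤ (∫_{[-a,a]} |e^{(s-1/2)t}|² dt)^{1/2} ‖f‖₂` (Cauchy–Schwarz on the window;
a `private`-style local copy of the lemma of `WeilGroundStateRealZerosProofs.lean`, whose module
cannot be imported next to `WeilWindowSimpleEven.lean`). [folklore] -/
theorem stub_calibration_END_of_RH_norm_weilMellin_le_sqrt {f : ℝ → ℂ} (hf : MemLp f 2 volume)
    (hfz : ∀ᵐ t, t ∉ Icc (-a) a → f t = 0) (s : ℂ) :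
    ‖weilMellin f s‖ ≤
      √(∫ t in Icc (-a) a, ‖cexp ((s - 1 / 2) * t)‖ ^ 2) * √(∫ t, ‖f t‖ ^ 2) := by
  unfold weilMellin
  rw [← setIntegral_eq_integral_of_ae_compl_eq_zero (s := Icc (-a) a)
    (hfz.mono fun t ht hts => by simp [ht hts])]
  have hE : MemLp (fun t : ℝ => cexp ((s - 1 / 2) * t)) 2 (volume.restrict (Icc (-a) a)) := by
    refine MemLp.of_bound
      (by fun_prop : Continuous fun t : ℝ => cexp ((s - 1 / 2) * t)).aestronglyMeasurable
      (Real.exp (|(s - 1 / 2).re| * |a|)) ?_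
    rw [ae_restrict_iff' measurableSet_Icc]
    refine Eventually.of_forall fun t ht => ?_
    rw [Complex.norm_exp, Real.exp_le_exp]
    have h1 : ((s - 1 / 2) * (t : ℂ)).re = (s - 1 / 2).re * t := by simp [mul_re]
    rw [h1]
    have ht' : |t| ≤ |a| := (abs_le.2 ⟨ht.1, ht.2⟩).trans (le_abs_self a)
    calc (s - 1 / 2).re * t ≤ |(s - 1 / 2).re * t| := le_abs_self _
      _ = |(s - 1 / 2).re| * |t| := abs_mul _ _
      _ ≤ |(s - 1 / 2).re| * |a| := mul_le_mul_of_nonneg_left ht' (abs_nonneg _)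
  have h := norm_integral_mul_le_sqrt (hf.restrict (Icc (-a) a)) hE
  refine h.trans ?_
  rw [mul_comm]
  refine mul_le_mul_of_nonneg_left (Real.sqrt_le_sqrt ?_) (Real.sqrt_nonneg _)
  exact setIntegral_le_integral ((memLp_two_iff_integrable_sq_norm hf.1).1 hf)
    (Eventually.of_forall fun t => by positivity)

/-- **`ĝₘ(s) → û(s)` along an `L²`-convergent sequence of window test functions**, for `u ∈ L²`
vanishing a.e. off the window. [folklore] -/
theorem stub_calibration_END_of_RH_tendsto_weilMellin (hu : MemLp u 2 volume)
    (hz : ∀ᵐ t : ℝ, t ∉ Icc (-a) a → u t = 0) {gs : ℕ → ℝ → ℂ}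
    (hgs : ∀ m, IsWeilTest (gs m) ∧ tsupport (gs m) ⊆ Icc (-a) a)
    (hL2 : Tendsto (fun m => ∫ t, ‖gs m t - u t‖ ^ 2) atTop (𝓝 0)) (s : ℂ) :
    Tendsto (fun m => weilMellin (gs m) s) atTop (𝓝 (weilMellin u s)) := by
  rw [tendsto_iff_norm_sub_tendsto_zero]
  set C := √(∫ t in Icc (-a) a, ‖cexp ((s - 1 / 2) * t)‖ ^ 2) with hC
  have hbound : ∀ m, ‖weilMellin (gs m) s - weilMellin u s‖ ≤
      C * √(∫ t, ‖gs m t - u t‖ ^ 2) := by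
    intro m
    have hsub : weilMellin (gs m) s - weilMellin u s = weilMellin (fun t => gs m t - u t) s := by
      unfold weilMellin
      rw [← integral_sub (integrable_weilIntegrand (hgs m).1.1.continuous (hgs m).1.2 s)
        (stub_calibration_END_of_RH_integrable_mul_continuous hu hz (by fun_prop))]
      congr 1 with t
      ring
    rw [hsub]
    refine stub_calibration_END_of_RH_norm_weilMellin_le_sqrt
      (((hgs m).1.1.continuous.memLp_of_hasCompactSupport (hgs m).1.2).sub hu) ?_ s
    filter_upwards [hz] with t ht hts
    have h1 : gs m t = 0 := image_eq_zero_of_notMem_tsupport fun h' => hts ((hgs m).2 h')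
    simp [h1, ht hts]
  refine squeeze_zero (fun _ => norm_nonneg _) hbound ?_
  have h := hL2.sqrt
  rw [Real.sqrt_zero] at h
  simpa using h.const_mul C

/-! ### Injectivity: `û ≡ 0` forces `u = 0` a.e. -/

/-- **Uniqueness** (registered anchor of this helper file, stated binder-free): if `u ∈ L²`
vanishes a.e. off the window and `û ≡ 0`, then `u = 0` a.e.
Indeed `u ∈ L¹ ∩ L²`, its Fourier transform is `𝓕 u (w) = û(1/2 − 2πiw) = 0`
(`fourier_weilKernel`), and Plancherel (`‖𝓕 u‖₂ = ‖u‖₂`,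
`Literature.Analysis.FunctionSpaces.eLpNorm_fourierIntegral_eq`) gives `‖u‖₂ = 0`. [folklore] -/
theorem stub_calibration_END_of_RH_ae_eq_zero_of_weilMellin_eq_zero : ∀ {a : ℝ} {u : ℝ → ℂ},
    MemLp u 2 volume → (∀ᵐ t : ℝ, t ∉ Set.Icc (-a) a → u t = 0) →
      (∀ s : ℂ, weilMellin u s = 0) → u =ᵐ[volume] 0 := by
  intro a u hu hz h0
  have hi : Integrable u := stub_calibration_END_of_RH_integrable hu hz
  have hF : ∀ w : ℝ, 𝓕 u w = 0 := by
    intro w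
    have h := fourier_weilKernel u (1 / 2) w
    have e : (fun t : ℝ => u t * cexp ((((1 / 2 : ℝ) : ℂ) - 1 / 2) * t)) = u := by
      funext t; push_cast; simp
    rw [e] at h
    rw [h, h0]
  have hF0 : (𝓕 u : ℝ → ℂ) = 0 := funext hF
  have hP := Literature.Analysis.FunctionSpaces.eLpNorm_fourierIntegral_eq hi hu
  rw [hF0, eLpNorm_zero] at hP
  exact (eLpNorm_eq_zero_iff hu.1 two_ne_zero).1 hP.symm

end Summit.RiemannHypothesis.RiemannHypothesis.Theorems.RuelleBandCofiniteCriticalLine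

end
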